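import Summits.Parity.GeneralizedHardyLittlewood.Theorems.LeeYangFibresAbsoluteUpgradeSinglesDecayScale
import HarnessLib

/-!
# Route `LeeYangFibres`, crux `FibreHyperbolicityAlong` (stmt-Parity-18103), line
# `sifted-chowla-distillation`: the one-scale sifted singles bound with an ABSTRACT Fundamental Lemma
# (helper file 2 of `stub_siftedSinglesAlong`)

The tree's one-scale engine of `stub_singlesDecay` (`Theorems.AbsoluteUpgrade.signed_sifted_sum_le`,
`singles_largeU`, helper files 7 and 10 of the line `nlc-cells-absolute-clip`) takes the Fundamental Lemma
in the fixed shape `C_FL X V(z) e^{−log D/log z}`.  To feed it the SHARP Fundamental Lemma (error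
`X V(z) (e^{−Ms} + C (log D)^{−1/3})`, helper file 1, from Iwaniec's Rosser sieve) we re-prove the two
statements with the sieve error abstracted to a number `ε`:

* `signed_sifted_sum_le_eps` — parity of a form over the sifted points of an interval:
  `|∑_{m ∈ I, (F(m),P(z))=1} λ(am+b)| ≤ ε #I V(z) + (Liouville class sums)`;
* `singles_largeU_eps` — the one-scale singles bound in the sieving regime `z = ⌊N^{1/u}⌋ + 1 ≤ D = N^{1/8}`:
  `|∑_{m ∈ I rough} λ(ψ_i(m))| ≤ t + (2 ε β_∞ ∏_p β_p (u/log N)^t + 1) + Rem` (`0 ≤ ε ≤ 1`).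

The proofs are copies of the tree proofs with the one Fundamental-Lemma line changed.

References: J. Friedlander, H. Iwaniec, *Opera de Cribro* (2010), Cor. 6.10 [FriedlanderIwaniecOpera2010];
B. Green, T. Tao, Ann. of Math. 171 (2010), §1 [GreenTao2010].
-/

noncomputable section

open Finset Polynomial ArithmeticFunction Filter

namespace Summit.Parity.GeneralizedHardyLittlewood.Cruxes.FibreHyperbolicityAlong.SiftedChowlaDistillation

open Literature.NumberTheory.Sieve
open Summit.Parity.GeneralizedHardyLittlewood.Cruxes.AbsoluteUpgrade.NlcCellsAbsoluteClip
open Summit.Parity.GeneralizedHardyLittlewood.Theorems.AbsoluteUpgrade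

variable {t : ℕ}

/-! ### Parity over the sifted points, abstract sieve error -/

set_option maxHeartbeats 800000 in
/-- **Parity of a form over the sifted points, abstract Fundamental Lemma** (the two main terms
cancel).  For `F ∈ ℤ[X]`, an interval `I = [m₁, m₂]` on which `F > 0` (values `≤ x_F`) and a form
`a m + b ≥ 1` on `I`: if every sifted sequence with density `ω_F(m)/m` obeys, at the sifting range
`P(z)` and level `D`, `|S(𝒜; x) − X V(z)| ≤ ε X V(z) + ∑_{d ∣ P(z), d ≤ D} |R_d(x)|`, then
`|∑_{m ∈ I, (F(m), P(z)) = 1} λ(a m + b)| ≤ ε · #I · V(z) + ∑_{d ≤ D sqfree} ∑_{s root mod d}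
(1 + |∑_{m ∈ I, m ≡ s (d)} λ(a m + b)|)`.  Proof copied from the tree's `signed_sifted_sum_le`
(helper file 7 of `stub_singlesDecay`), with the Fundamental Lemma abstracted to the error `ε`.
[cite: FriedlanderIwaniecOpera2010, Cor. 6.10] -/
theorem signed_sifted_sum_le_eps {F : Polynomial ℤ} {ε z D : ℝ}
    (hFL : ∀ A : SieveSequence, A.density = rootDensity F → ∀ x : ℝ, 0 ≤ A.size x →
      |A.sifted x (primesProdBelow z) - A.size x * A.densityProduct (primesProdBelow z)| ≤
        ε * A.size x * A.densityProduct (primesProdBelow z) +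
          ∑ d ∈ (primesProdBelow z).divisors.filter (fun d : ℕ => (d : ℝ) ≤ D), |A.remainder d x|)
    {a b m₁ m₂ : ℤ} (hab : ∀ m ∈ Icc m₁ m₂, 1 ≤ a * m + b)
    {xF : ℝ} (hxF : ∀ m ∈ Icc m₁ m₂, 0 < F.eval m ∧ ((F.eval m : ℤ) : ℝ) ≤ xF) :
    |∑ m ∈ (Icc m₁ m₂).filter (fun m : ℤ => (F.eval m).natAbs.Coprime (primesProdBelow z)),
        (liouville (a * m + b).toNat : ℝ)| ≤
      ε * #(Icc m₁ m₂) * (∏ p ∈ Nat.primesBelow ⌈z⌉₊, (1 - (polyRootCountMod ![F] p : ℝ) / p)) +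
        ∑ d ∈ (Icc 1 ⌊D⌋₊).filter Squarefree, ∑ s ∈ rootsMod F d,
          (1 + |∑ m ∈ (Icc m₁ m₂).filter (fun m : ℤ => m ≡ (s : ℤ) [ZMOD d]),
            (liouville (a * m + b).toNat : ℝ)|) := by
  -- adapted from `Theorems.AbsoluteUpgrade.signed_sifted_sum_le` (tree, helper file 7 of `stub_singlesDecay`)
  set I := Icc m₁ m₂ with hIdef
  set P := primesProdBelow z with hP
  set V := ∏ p ∈ Nat.primesBelow ⌈z⌉₊, (1 - (polyRootCountMod ![F] p : ℝ) / p) with hVdef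
  set X : ℝ := #I / 2 with hX
  set Lam : ℕ → ℕ → ℝ := fun d s => ∑ m ∈ I.filter (fun m : ℤ => m ≡ (s : ℤ) [ZMOD d]),
    (liouville (a * m + b).toNat : ℝ) with hLam
  set S : ℤ → Finset ℤ := fun ν => I.filter (fun m : ℤ => liouville (a * m + b).toNat = ν) with hS
  have hxS : ∀ ν, ∀ m ∈ S ν, 0 < F.eval m ∧ ((F.eval m : ℤ) : ℝ) ≤ xF := fun ν m hm =>
    hxF m (Finset.mem_filter.mp hm).1
  set A : ℤ → SieveSequence := fun ν => valSeq F (S ν) X with hA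
  have hX0 : 0 ≤ X := by positivity
  have hV0 : 0 ≤ V := prod_one_sub_rootCount_nonneg F z
  -- the sifted sums count the sign classes of the sifted points
  have hsift : ∀ ν, (A ν).sifted xF P =
      #((I.filter (fun m : ℤ => (F.eval m).natAbs.Coprime P)).filter
        (fun m : ℤ => liouville (a * m + b).toNat = ν)) := by
    intro ν
    rw [hA, valSeq_sifted F (S ν) X (hxS ν) P, hS, Finset.filter_filter, Finset.filter_filter]
    congr 2
    refine Finset.filter_congr fun m _ => ?_
    exact and_comm
  have hsize : ∀ ν x, (A ν).size x = X := fun ν x => rfl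
  have hdens : ∀ ν, (A ν).densityProduct P = V := fun ν => valSeq_densityProduct F (S ν) X z
  -- the Fundamental Lemma for each sign
  have hFLν : ∀ ν, |(A ν).sifted xF P - X * V| ≤ ε * X * V +
      ∑ d ∈ P.divisors.filter (fun d : ℕ => (d : ℝ) ≤ D), |(A ν).remainder d xF| := by
    intro ν
    have h := hFL (A ν) rfl xF (by rw [hsize]; exact hX0)
    rwa [hdens ν, hsize] at h
  -- the remainders, class by class
  have hRd : ∀ ν : ℤ, (ν = 1 ∨ ν = -1) → ∀ d ∈ P.divisors.filter (fun d : ℕ => (d : ℝ) ≤ D),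
      |(A ν).remainder d xF| ≤ (1 / 2) * ∑ s ∈ rootsMod F d, (1 + |Lam d s|) := by
    intro ν hν d hd
    have hd0 : 0 < d := Nat.pos_of_mem_divisors (Finset.mem_filter.mp hd).1
    refine (abs_valSeq_remainder_le F (S ν) X (hxS ν) hd0).trans ?_
    rw [Finset.mul_sum]
    refine Finset.sum_le_sum fun s _ => ?_
    have hset : (S ν).filter (fun n : ℤ => n ≡ (s : ℤ) [ZMOD d]) =
        (I.filter (fun m : ℤ => m ≡ (s : ℤ) [ZMOD d])).filter
          (fun m : ℤ => liouville (a * m + b).toNat = ν) := by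
      rw [hS, Finset.filter_filter, Finset.filter_filter]
      exact Finset.filter_congr fun m _ => and_comm
    have hcl := card_filter_liouville_eq (I.filter (fun m : ℤ => m ≡ (s : ℤ) [ZMOD d]))
      (fun m hm => hab m (Finset.mem_filter.mp hm).1) hν
    have hcnt := abs_card_Icc_filter_modEq_sub_le hd0 m₁ m₂ (s : ℤ)
    rw [hset, hcl]
    have hνabs : |((ν : ℤ) : ℝ)| = 1 := by rcases hν with rfl | rfl <;> simp
    calc |(1 / 2 : ℝ) * #(I.filter (fun m : ℤ => m ≡ (s : ℤ) [ZMOD d])) +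
            (1 / 2) * ν * Lam d s - X / d|
        = |(1 / 2 : ℝ) * ((#(I.filter (fun m : ℤ => m ≡ (s : ℤ) [ZMOD d])) : ℝ) - (#I : ℝ) / d) +
            (1 / 2) * ν * Lam d s| := by rw [hX]; ring_nf
      _ ≤ |(1 / 2 : ℝ) * ((#(I.filter (fun m : ℤ => m ≡ (s : ℤ) [ZMOD d])) : ℝ) - (#I : ℝ) / d)| +
            |(1 / 2 : ℝ) * ν * Lam d s| := abs_add_le _ _
      _ ≤ (1 / 2) * 1 + (1 / 2) * |Lam d s| := by
          rw [abs_mul, abs_mul, abs_mul, hνabs, abs_of_pos (by norm_num : (0 : ℝ) < 1 / 2)]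
          have := mul_le_mul_of_nonneg_left hcnt (by norm_num : (0 : ℝ) ≤ 1 / 2)
          linarith
      _ = (1 / 2) * (1 + |Lam d s|) := by ring
  have hRsum : ∀ ν : ℤ, (ν = 1 ∨ ν = -1) →
      ∑ d ∈ P.divisors.filter (fun d : ℕ => (d : ℝ) ≤ D), |(A ν).remainder d xF| ≤
        (1 / 2) * ∑ d ∈ (Icc 1 ⌊D⌋₊).filter Squarefree, ∑ s ∈ rootsMod F d, (1 + |Lam d s|) := by
    intro ν hν
    calc _ ≤ ∑ d ∈ P.divisors.filter (fun d : ℕ => (d : ℝ) ≤ D),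
          (1 / 2) * ∑ s ∈ rootsMod F d, (1 + |Lam d s|) := Finset.sum_le_sum (hRd ν hν)
      _ = (1 / 2) * ∑ d ∈ P.divisors.filter (fun d : ℕ => (d : ℝ) ≤ D),
          ∑ s ∈ rootsMod F d, (1 + |Lam d s|) := by rw [Finset.mul_sum]
      _ ≤ _ := by
          refine mul_le_mul_of_nonneg_left ?_ (by norm_num)
          exact Finset.sum_le_sum_of_subset_of_nonneg (divisors_filter_subset z D)
            fun d _ _ => Finset.sum_nonneg fun s _ => by positivity
  -- assembly
  have hsum : ∑ m ∈ I.filter (fun m : ℤ => (F.eval m).natAbs.Coprime P),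
      (liouville (a * m + b).toNat : ℝ) = (A 1).sifted xF P - (A (-1)).sifted xF P := by
    rw [hsift 1, hsift (-1)]
    exact sum_liouville_eq_card_sub_card _ (fun m hm => hab m (Finset.mem_filter.mp hm).1)
  rw [hsum]
  have h1 := hFLν 1
  have h2 := hFLν (-1)
  have hR1 := hRsum 1 (Or.inl rfl)
  have hR2 := hRsum (-1) (Or.inr rfl)
  calc |(A 1).sifted xF P - (A (-1)).sifted xF P|
      = |((A 1).sifted xF P - X * V) - ((A (-1)).sifted xF P - X * V)| := by ring_nf
    _ ≤ |(A 1).sifted xF P - X * V| + |(A (-1)).sifted xF P - X * V| := abs_sub _ _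
    _ ≤ (ε * X * V + (1 / 2) * ∑ d ∈ (Icc 1 ⌊D⌋₊).filter Squarefree,
            ∑ s ∈ rootsMod F d, (1 + |Lam d s|)) +
          (ε * X * V + (1 / 2) * ∑ d ∈ (Icc 1 ⌊D⌋₊).filter Squarefree,
            ∑ s ∈ rootsMod F d, (1 + |Lam d s|)) :=
        add_le_add (h1.trans (add_le_add le_rfl hR1)) (h2.trans (add_le_add le_rfl hR2))
    _ = ε * #I * V + ∑ d ∈ (Icc 1 ⌊D⌋₊).filter Squarefree,
          ∑ s ∈ rootsMod F d, (1 + |Lam d s|) := by rw [hX]; ring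


/-! ### The one-scale singles bound in the sieving regime, abstract sieve error -/

/-- **One-scale singles bound, sieving regime, abstract Fundamental Lemma** (`z = ⌊N^{1/u}⌋ + 1 ≤
D = N^{1/8}`).  For a non-degenerate `Ψ` with `|a_k| ≤ L`, an integer interval `I = [m₁, m₂]` on which
every form is `≥ 1`, with `#I ≤ β_∞ + 1`, roughness `N^{1/u} ≥ 2` with `⌊N^{1/u}⌋ ≥ max(L, 4t², 1)`, and a
sieve error `0 ≤ ε ≤ 1` valid for every sifted sequence of density `ω_{F_Ψ}(m)/m` at the range `P(z)` and
level `D`: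
`|∑_{m ∈ I, all ψ_k(m) rough} λ(ψ_i(m))| ≤ t + (2 ε β_∞ ∏_p β_p (u/log N)^t + 1) + Rem`,
`Rem` any bound for the Liouville class sums.  Proof copied from the tree's `singles_largeU`
(helper file 10 of `stub_singlesDecay`) with `C_FL e^{−log D/log z}` replaced by `ε`.
[cite: FriedlanderIwaniecOpera2010, Cor. 6.10] [cite: GreenTao2010, (1.6)–(1.7)] -/
theorem singles_largeU_eps {Ψ : Fin t → AffLinForm 1} (hΨ : IsNondegenerateSystem Ψ) {L : ℕ}
    (haL : ∀ k, ((Ψ k).coeff 0).natAbs ≤ L)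
    {m₁ m₂ : ℤ} (hI : ∀ m ∈ Icc m₁ m₂, ∀ k, 1 ≤ (Ψ k).eval (fun _ => m))
    {AF : ℝ} (hAF : 0 ≤ AF) (hcard : (#(Icc m₁ m₂) : ℝ) ≤ AF + 1)
    {N u : ℕ} (hu : 1 ≤ u) (hy2 : (2 : ℝ) ≤ (N : ℝ) ^ ((1 : ℝ) / u))
    (hhead : L ≤ ⌊(N : ℝ) ^ ((1 : ℝ) / u)⌋₊ ∧ 4 * t ^ 2 ≤ ⌊(N : ℝ) ^ ((1 : ℝ) / u)⌋₊ ∧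
      1 ≤ ⌊(N : ℝ) ^ ((1 : ℝ) / u)⌋₊)
    {ε : ℝ} (hε0 : 0 ≤ ε) (hε1 : ε ≤ 1)
    (hFL : ∀ A : SieveSequence, A.density = rootDensity (sysPoly Ψ) → ∀ x : ℝ, 0 ≤ A.size x →
      |A.sifted x (primesProdBelow (((⌊(N : ℝ) ^ ((1 : ℝ) / u)⌋₊ + 1 : ℕ) : ℝ))) -
          A.size x * A.densityProduct (primesProdBelow (((⌊(N : ℝ) ^ ((1 : ℝ) / u)⌋₊ + 1 : ℕ) : ℝ)))| ≤
        ε * A.size x * A.densityProduct (primesProdBelow (((⌊(N : ℝ) ^ ((1 : ℝ) / u)⌋₊ + 1 : ℕ) : ℝ))) +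
          ∑ d ∈ (primesProdBelow (((⌊(N : ℝ) ^ ((1 : ℝ) / u)⌋₊ + 1 : ℕ) : ℝ))).divisors.filter
            (fun d : ℕ => (d : ℝ) ≤ (N : ℝ) ^ ((1 : ℝ) / 8)), |A.remainder d x|)
    (i : Fin t) {Rem : ℝ}
    (hRem : ∑ d ∈ (Icc 1 ⌊(N : ℝ) ^ ((1 : ℝ) / 8)⌋₊).filter Squarefree,
      ∑ s ∈ rootsMod (sysPoly Ψ) d,
        (1 + |∑ m ∈ (Icc m₁ m₂).filter (fun m : ℤ => m ≡ (s : ℤ) [ZMOD d]),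
          (liouville ((Ψ i).coeff 0 * m + (Ψ i).const).toNat : ℝ)|) ≤ Rem) :
    |∑ m ∈ (Icc m₁ m₂).filter (fun m : ℤ => ∀ k, (N : ℝ) ^ ((1 : ℝ) / u) <
        (Nat.minFac ((Ψ k).eval (fun _ => m)).toNat : ℝ)),
      (liouville ((Ψ i).coeff 0 * m + (Ψ i).const).toNat : ℝ)| ≤
      t + (2 * ε * (AF * singularProduct Ψ) * ((u : ℝ) / Real.log N) ^ t + 1) + Rem := by
  -- adapted from `Theorems.AbsoluteUpgrade.singles_largeU` (tree, helper file 10 of `stub_singlesDecay`)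
  set y : ℝ := (N : ℝ) ^ ((1 : ℝ) / u) with hy
  set z : ℝ := ((⌊y⌋₊ + 1 : ℕ) : ℝ) with hz
  set a : ℤ := (Ψ i).coeff 0 with ha
  set b : ℤ := (Ψ i).const with hb
  set F := sysPoly Ψ with hF
  have hy1 : (1 : ℝ) ≤ y := by linarith
  have hyz : y < z := by rw [hz]; push_cast; exact Nat.lt_floor_add_one y
  have hz1 : (1 : ℝ) < z := lt_of_le_of_lt hy1 hyz
  have hceil : ⌈z⌉₊ - 1 = ⌊y⌋₊ := by rw [hz, Nat.ceil_natCast, Nat.add_sub_cancel]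
  -- Step 1: rough points versus sifted points (differ by at most `t`)
  have hab : ∀ m ∈ Icc m₁ m₂, 1 ≤ a * m + b := fun m hm => by
    have := hI m hm i; rwa [DimOne.eval_eq] at this
  have h1 := abs_sum_rough_sub_sum_coprime_le hΨ hI hy1
    (fun m : ℤ => (liouville (a * m + b).toNat : ℝ)) (fun m => Theorems.AbsoluteUpgrade.abs_liouville_le_one _)
  -- Step 2: the (abstract) Fundamental Lemma on the two sign classes
  have hFpos : ∀ m ∈ Icc m₁ m₂, 0 < F.eval m ∧ ((F.eval m : ℤ) : ℝ) ≤ ∑ m' ∈ Icc m₁ m₂, ((F.eval m' : ℤ) : ℝ) := by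
    have hpos : ∀ m ∈ Icc m₁ m₂, 0 < F.eval m := fun m hm => by
      rw [hF, sysPoly_eval]
      exact Finset.prod_pos fun k _ => lt_of_lt_of_le zero_lt_one (hI m hm k)
    intro m hm
    refine ⟨hpos m hm, ?_⟩
    have h := Finset.single_le_sum (f := fun m' : ℤ => F.eval m') (fun m' hm' => (hpos m' hm').le) hm
    exact_mod_cast h
  have h2 := signed_sifted_sum_le_eps hFL hab hFpos
  -- Step 3: the main term
  have hV1 := prod_one_sub_rootCount_le_one F z
  have hV0 := prod_one_sub_rootCount_nonneg F z
  have hW : 1 / Real.log z ≤ (u : ℝ) / Real.log N :=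
    one_div_log_le hu (by rw [← hy]; linarith) hyz
  have hhead' : L ≤ ⌈z⌉₊ - 1 ∧ 4 * t ^ 2 ≤ ⌈z⌉₊ - 1 ∧ 1 ≤ ⌈z⌉₊ - 1 := by
    rw [hceil]; exact hhead
  have hV := prod_one_sub_rootCount_le_main hΨ haL hz1 hhead' hW
  have hSP : 0 ≤ singularProduct Ψ :=
    ge_of_tendsto' (tendsto_singularProductPartial_holds 1 t Ψ hΨ)
      fun x => Finset.prod_nonneg fun p _ => localFactor_nonneg Ψ p
  have hWt : 0 ≤ ((u : ℝ) / Real.log N) ^ t := by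
    have : 0 ≤ (u : ℝ) / Real.log N := le_trans (by have := Real.log_pos hz1; positivity) hW
    positivity
  have hmain := main_term_le zero_le_one hcard hAF hSP hWt hV0 hV1 hV hε0 hε1 le_rfl
  -- Step 4: assemble
  have htri : |∑ m ∈ (Icc m₁ m₂).filter (fun m : ℤ => ∀ k, y < (Nat.minFac ((Ψ k).eval (fun _ => m)).toNat : ℝ)),
      (liouville (a * m + b).toNat : ℝ)| ≤
      t + |∑ m ∈ (Icc m₁ m₂).filter (fun m : ℤ => (F.eval m).natAbs.Coprime (primesProdBelow z)),
        (liouville (a * m + b).toNat : ℝ)| := by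
    have h1' : |∑ m ∈ (Icc m₁ m₂).filter (fun m : ℤ => ∀ k, y < (Nat.minFac ((Ψ k).eval (fun _ => m)).toNat : ℝ)),
        (liouville (a * m + b).toNat : ℝ) -
        ∑ m ∈ (Icc m₁ m₂).filter (fun m : ℤ => (F.eval m).natAbs.Coprime (primesProdBelow z)),
          (liouville (a * m + b).toNat : ℝ)| ≤ t := h1
    have := abs_sub_abs_le_abs_sub
      (∑ m ∈ (Icc m₁ m₂).filter (fun m : ℤ => ∀ k, y < (Nat.minFac ((Ψ k).eval (fun _ => m)).toNat : ℝ)),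
        (liouville (a * m + b).toNat : ℝ))
      (∑ m ∈ (Icc m₁ m₂).filter (fun m : ℤ => (F.eval m).natAbs.Coprime (primesProdBelow z)),
        (liouville (a * m + b).toNat : ℝ))
    linarith [h1']
  calc _ ≤ t + |∑ m ∈ (Icc m₁ m₂).filter (fun m : ℤ => (F.eval m).natAbs.Coprime (primesProdBelow z)),
        (liouville (a * m + b).toNat : ℝ)| := htri
    _ ≤ t + (ε * #(Icc m₁ m₂) * (∏ p ∈ Nat.primesBelow ⌈z⌉₊, (1 - (polyRootCountMod ![F] p : ℝ) / p)) +
          Rem) := by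
        have := h2.trans (add_le_add le_rfl hRem)
        linarith
    _ ≤ _ := by linarith [hmain]

/-! ## Registered-stub form (for `--supports stmt-Parity-18103`) -/

/-- **Stub form of `singles_largeU_eps`** (sub-goal of the line `sifted-chowla-distillation`, to be registered
as `stub_siftedSinglesAtScale`; the header below is the registered one-line signature verbatim, fully
qualified). [cite: FriedlanderIwaniecOpera2010, Cor. 6.10] -/
theorem stub_siftedSinglesAtScale : ∀ (t L N u : ℕ) (Ψ : Fin t → Literature.NumberTheory.Sieve.AffLinForm 1) (m₁ m₂ : ℤ) (AF ε Rem : ℝ) (i : Fin t), Literature.NumberTheory.Sieve.IsNondegenerateSystem Ψ → (∀ k, ((Ψ k).coeff 0).natAbs ≤ L) → (∀ m ∈ Finset.Icc m₁ m₂, ∀ k, 1 ≤ (Ψ k).eval (fun _ => m)) → 0 ≤ AF → ((Finset.Icc m₁ m₂).card : ℝ) ≤ AF + 1 → 1 ≤ u → (2 : ℝ) ≤ (N : ℝ) ^ ((1 : ℝ) / u) → (L ≤ ⌊(N : ℝ) ^ ((1 : ℝ) / u)⌋₊ ∧ 4 * t ^ 2 ≤ ⌊(N : ℝ) ^ ((1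 : ℝ) / u)⌋₊ ∧ 1 ≤ ⌊(N : ℝ) ^ ((1 : ℝ) / u)⌋₊) → 0 ≤ ε → ε ≤ 1 → (∀ A : Literature.NumberTheory.Sieve.SieveSequence, A.density = Literature.NumberTheory.Sieve.rootDensity (Summit.Parity.GeneralizedHardyLittlewood.Theorems.AbsoluteUpgrade.sysPoly Ψ) → ∀ x : ℝ, 0 ≤ A.size x → |A.sifted x (Literature.NumberTheory.Sieve.primesProdBelow (((⌊(N : ℝ) ^ ((1 : ℝ) / u)⌋₊ + 1 : ℕ) : ℝ))) - A.size x * A.densityProduct (Literature.NumberTheory.Sieve.primesProdBelow (((⌊(N : ℝ) ^ ((1 : ℝ) / u)⌋₊ + 1 : ℕ) : ℝ)))| ≤ ε * A.size x * A.densityProduct (Literature.NumberTheory.Sieve.primesProdBelow (((⌊(N : ℝ) ^ ((1 : ℝ) / u)⌋₊ + 1 : ℕ) : ℝ))) + ∑ d ∈ (Literature.NumberTheory.Sieve.primesProdBelow (((⌊(N : ℝ) ^ ((1 : ℝ) / u)⌋₊ + 1 : ℕ) : ℝ))).divisors.filter (fun d : ℕ => (d : ℝ) ≤ (N : ℝ)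 ^ ((1 : ℝ) / 8)), |A.remainder d x|) → (∑ d ∈ (Finset.Icc 1 ⌊(N : ℝ) ^ ((1 : ℝ) / 8)⌋₊).filter Squarefree, ∑ s ∈ Summit.Parity.GeneralizedHardyLittlewood.Theorems.AbsoluteUpgrade.rootsMod (Summit.Parity.GeneralizedHardyLittlewood.Theorems.AbsoluteUpgrade.sysPoly Ψ) d, (1 + |∑ m ∈ (Finset.Icc m₁ m₂).filter (fun m : ℤ => m ≡ (s : ℤ) [ZMOD d]), (ArithmeticFunction.liouville ((Ψ i).coeff 0 * m + (Ψ i).const).toNat : ℝ)|) ≤ Rem) → |∑ m ∈ (Finset.Icc m₁ m₂).filter (fun m : ℤ => ∀ k, (N : ℝ) ^ ((1 : ℝ) / u) < (Nat.minFac ((Ψ k).eval (fun _ => m)).toNat : ℝ)), (ArithmeticFunction.liouville ((Ψ i).coeff 0 * m + (Ψ i).const).toNat : ℝ)| ≤ t + (2 * ε * (AF * Literature.NumberTheory.Sieve.singularProduct Ψ) * ((u : ℝ) / Real.log N) ^ t + 1) + Rem :=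
  fun _ _ _ _ _ _ _ _ _ _ i hΨ haL hI hAF hcard hu hy2 hhead hε0 hε1 hFL hRem =>
    singles_largeU_eps hΨ haL hI hAF hcard hu hy2 hhead hε0 hε1 hFL i hRem

end Summit.Parity.GeneralizedHardyLittlewood.Cruxes.FibreHyperbolicityAlong.SiftedChowlaDistillation

end
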